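/-
Copyright (c) 2026 the pub-hodgecm-mathlib formalisation cell (harness21).  Prover seat hodgecm-mathlib-K2Liu-p05 (g4), 2026-09-04
(Track B «K2-LIT», crux hLiu418 = stmt-HodgeConjecture-24832, LEAD F0P6-plan (g13) RULING M-157s organ (SD-1-ind), file (V-L2′):
the `h`-line of Shimura's `ξ(1, ·)` IS a `g`-line of `ξ(·, h)` up to an explicit scalar — one GL-equivariance call per `t`).
-/
import Summits.HodgeConjecture.HodgeConjecture.Theorems.K2LiuArchWhittakerLeviEquivariance    -- ★ (V-L1′) K2E5-p16 (g5): `xiTwo_levi`, `det_conj_eq`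
import Literature.NumberTheory.Weil1964.ArchUnitaryBallTransitive                           -- ★ `CFC.sqrt` helpers (`sqrt_mul_sqrt_of_posDef`, …)
import HarnessLib

/-!
# (SD-1-ind, V-L2′) The `h`-line as a `g`-line: `ξ(1, h + tΘ; α, β) = det(1 + tΞ)^{α+β−2} · ξ(1 + tΞ, h; α, β)`, `Ξ = h^{−½} Θ h^{−½}`

Track B ∕ K2-LIT, hLiu418 = stmt-HodgeConjecture-24832; LEAD F0P6-plan (g13) RULING M-157s (+ correction 09:58Z): «for `h` PosDef, `Θ` hermitian, real `t`
small, `a_t := h^{−1∕2}(h+tΘ)^{1∕2}`, `Ξ := h^{−1∕2}Θh^{−1∕2}`: `a_tᴴ h a_t = h + tΘ`, `a_t a_tᴴ = 1 + tΞ`, `‖det a_t‖² = det(1+tΞ)`, and ONE call of ★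
`xiTwo_levi` with `g := 1` gives the pointwise identity — no smoothness of `a_t` is used».  Namespace
`Summit.HodgeConjecture.HodgeConjecture.Cruxes.HLiu418.K2LiuXiTwoHLineAsGLine`.  THEOREMS ONLY; `--supports stmt-HodgeConjecture-24832 --as helper`.

* §1 the bridge matrices: `R = h^{1∕2}` (`CFC.sqrt`), `S_t = (h + tΘ)^{1∕2}`, `a_t = R⁻¹ S_t`, `Ξ = R⁻¹ Θ R⁻¹` (hermitian): `a_t a_tᴴ = 1 + tΞ`, `a_tᴴ h a_t = h + tΘ`,
  `det a_t ≠ 0`, `‖det a_t‖² = det(1 + tΞ)` (so `det(1 + tΞ)` is a positive real);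
* §2 **`xiTwo_hLine_eq_gLine`**: for `h > 0`, `Θ` hermitian, `t ∈ ℝ` with `h + tΘ > 0` and all `α, β`:
  `xiTwo 1 (h + t•Θ) α β = (1 + t•Ξ).det ^ (α + β − 2) * xiTwo (1 + t•Ξ) h α β` (K2E5-p16's ★ `xiTwo_levi` BY NAME at `a := a_t`, `g := 1`);
* §3 `eventually_posDef_add_smul`: `h + tΘ > 0` for all real `t` near `0` — so §2 holds on a neighbourhood of `t = 0` and transfers `iteratedDeriv` at `0`
  ((V-4): ★ `exists_whittaker_eq_sum_iteratedDeriv_hLine` + this file + Leibniz ⇒ LEAD's `g`-line letter).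

HONEST LABEL: HC_CM is proved only modulo the 7 printed citations (2 remaining named inputs: hLiu418 = stmt-HodgeConjecture-24832, h413 =
stmt-HodgeConjecture-24833) until rung 0 closes; organ capital, moves no counter.

## References
G. Shimura, *Confluent hypergeometric functions on tube domains*, Math. Ann. 260 (1982), (1.16)∕§3 (the `GL`-equivariance of `ξ`); [Shimura1997] §16.
-/

set_option autoImplicit false
set_option linter.dupNamespace false

noncomputable section

open scoped Matrix ComplexConjugate ComplexOrder MatrixOrder Topology
open Complex Matrix Filter
open Literature.NumberTheory.Weil1964.UnitaryBall (sqrt_mul_sqrt_of_posDef conjTranspose_sqrt isUnit_det_sqrt_of_posDef sqrt_inv_mul_mul_sqrt_inv)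
open Summit.HodgeConjecture.HodgeConjecture.Cruxes.HLiu418.K2LiuHermTwoGammaDefs
open Summit.HodgeConjecture.HodgeConjecture.Cruxes.HLiu418.K2LiuHermTwoConfluentXiDefs
open Summit.HodgeConjecture.HodgeConjecture.Cruxes.HLiu418.K2LiuArchWhittakerLeviEquivariance

namespace Summit.HodgeConjecture.HodgeConjecture.Cruxes.HLiu418.K2LiuXiTwoHLineAsGLine

variable {n : Type*} [Fintype n] [DecidableEq n]

/-! ## §1 The bridge matrices -/

/-- `(R⁻¹)ᴴ = R⁻¹` for `R = M^{1∕2}`. [folklore] -/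
theorem conjTranspose_sqrt_inv (M : Matrix n n ℂ) : ((CFC.sqrt M)⁻¹)ᴴ = (CFC.sqrt M)⁻¹ := by
  rw [conjTranspose_nonsing_inv, conjTranspose_sqrt]

/-- **the bridge direction `Ξ = h^{−½} Θ h^{−½}` is hermitian** when `Θ` is. [folklore] -/
theorem conjTranspose_bridgeDir (h : Matrix n n ℂ) {Θ : Matrix n n ℂ} (hΘ : Θᴴ = Θ) :
    ((CFC.sqrt h)⁻¹ * Θ * (CFC.sqrt h)⁻¹)ᴴ = (CFC.sqrt h)⁻¹ * Θ * (CFC.sqrt h)⁻¹ := by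
  rw [conjTranspose_mul, conjTranspose_mul, conjTranspose_sqrt_inv, hΘ, Matrix.mul_assoc]

/-- **`a_t a_tᴴ = 1 + tΞ`** for `a_t = h^{−½}(h + tΘ)^{½}` (`h, h + tΘ > 0`). [folklore] -/
theorem bridge_mul_conjTranspose {h Θ : Matrix n n ℂ} (hh : h.PosDef) {t : ℝ} (ht : (h + (t : ℂ) • Θ).PosDef) :
    ((CFC.sqrt h)⁻¹ * CFC.sqrt (h + (t : ℂ) • Θ)) * ((CFC.sqrt h)⁻¹ * CFC.sqrt (h + (t : ℂ) • Θ))ᴴ =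
      1 + (t : ℂ) • ((CFC.sqrt h)⁻¹ * Θ * (CFC.sqrt h)⁻¹) := by
  rw [conjTranspose_mul, conjTranspose_sqrt, conjTranspose_sqrt_inv, Matrix.mul_assoc, ← Matrix.mul_assoc (CFC.sqrt (h + (t : ℂ) • Θ)),
    sqrt_mul_sqrt_of_posDef ht, Matrix.add_mul, Matrix.mul_add, ← Matrix.mul_assoc, sqrt_inv_mul_mul_sqrt_inv hh, Matrix.smul_mul,
    Matrix.mul_smul, Matrix.mul_assoc]

/-- **`a_tᴴ h a_t = h + tΘ`**. [folklore] -/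
theorem conjTranspose_bridge_mul {h Θ : Matrix n n ℂ} (hh : h.PosDef) {t : ℝ} (ht : (h + (t : ℂ) • Θ).PosDef) :
    ((CFC.sqrt h)⁻¹ * CFC.sqrt (h + (t : ℂ) • Θ))ᴴ * h * ((CFC.sqrt h)⁻¹ * CFC.sqrt (h + (t : ℂ) • Θ)) = h + (t : ℂ) • Θ := by
  rw [conjTranspose_mul, conjTranspose_sqrt, conjTranspose_sqrt_inv, Matrix.mul_assoc, Matrix.mul_assoc, ← Matrix.mul_assoc ((CFC.sqrt h)⁻¹) h,
    ← Matrix.mul_assoc ((CFC.sqrt h)⁻¹ * h), sqrt_inv_mul_mul_sqrt_inv hh, Matrix.one_mul, sqrt_mul_sqrt_of_posDef ht]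

/-- `det a_t ≠ 0`. [folklore] -/
theorem det_bridge_ne_zero {h Θ : Matrix n n ℂ} (hh : h.PosDef) {t : ℝ} (ht : (h + (t : ℂ) • Θ).PosDef) :
    ((CFC.sqrt h)⁻¹ * CFC.sqrt (h + (t : ℂ) • Θ)).det ≠ 0 := by
  rw [det_mul, det_nonsing_inv, Ring.inverse_eq_inv']
  exact mul_ne_zero (inv_ne_zero (isUnit_det_sqrt_of_posDef hh).ne_zero) (isUnit_det_sqrt_of_posDef ht).ne_zero

/-- **`‖det a_t‖² = det(1 + tΞ)`** — in particular `det(1 + tΞ)` is the positive real `‖det a_t‖²`. [folklore] -/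
theorem det_one_add_smul_bridgeDir {h Θ : Matrix n n ℂ} (hh : h.PosDef) {t : ℝ} (ht : (h + (t : ℂ) • Θ).PosDef) :
    (1 + (t : ℂ) • ((CFC.sqrt h)⁻¹ * Θ * (CFC.sqrt h)⁻¹)).det =
      ((‖((CFC.sqrt h)⁻¹ * CFC.sqrt (h + (t : ℂ) • Θ)).det‖ ^ 2 : ℝ) : ℂ) := by
  rw [← bridge_mul_conjTranspose hh ht, det_mul, det_conjTranspose, Complex.star_def, Complex.mul_conj, Complex.normSq_eq_norm_sq]

/-! ## §2 The pointwise identity -/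

/-- for `r > 0`: `(r : ℂ)^{2w} = (r² : ℂ)^{w}`. [folklore] -/
theorem ofReal_cpow_two_mul {r : ℝ} (hr : 0 < r) (w : ℂ) : ((r : ℝ) : ℂ) ^ (2 * w) = ((r ^ 2 : ℝ) : ℂ) ^ w := by
  rw [cpow_def_of_ne_zero (by exact_mod_cast hr.ne'), cpow_def_of_ne_zero (by exact_mod_cast (pow_pos hr 2).ne'),
    ← Complex.ofReal_log hr.le, ← Complex.ofReal_log (pow_pos hr 2).le, Real.log_pow]
  push_cast
  ring_nf

/-- **THE `h`-LINE IS A `g`-LINE (pointwise)**: for `h > 0`, `Θ` hermitian and real `t` with `h + tΘ > 0`,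
`ξ(1, h + tΘ; α, β) = det(1 + tΞ)^{α + β − 2} · ξ(1 + tΞ, h; α, β)`, `Ξ = h^{−½} Θ h^{−½}` — ONE call of K2E5-p16 (g5)'s ★ GL-equivariance `xiTwo_levi`
at `a := h^{−½}(h + tΘ)^{½}`, `g := 1`. [cite: Shimura1997, §16.4] -/
theorem xiTwo_hLine_eq_gLine {h Θ : Matrix (Fin 2) (Fin 2) ℂ} (hh : h.PosDef) {t : ℝ} (ht : (h + (t : ℂ) • Θ).PosDef) (α β : ℂ) :
    xiTwo 1 (h + (t : ℂ) • Θ) α β =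
      (1 + (t : ℂ) • ((CFC.sqrt h)⁻¹ * Θ * (CFC.sqrt h)⁻¹)).det ^ (α + β - 2) * xiTwo (1 + (t : ℂ) • ((CFC.sqrt h)⁻¹ * Θ * (CFC.sqrt h)⁻¹)) h α β := by
  have ha := det_bridge_ne_zero hh ht
  have hr : 0 < ‖((CFC.sqrt h)⁻¹ * CFC.sqrt (h + (t : ℂ) • Θ)).det‖ := norm_pos_iff.2 ha
  have hlevi := xiTwo_levi ha 1 h α β
  rw [Matrix.mul_one, bridge_mul_conjTranspose hh ht, conjTranspose_bridge_mul hh ht] at hlevi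
  -- the scalar: `‖det a‖^{4 − 2α − 2β} = det(1 + tΞ)^{2 − α − β}`, inverse `det(1 + tΞ)^{α + β − 2}`
  have hscal : (((‖((CFC.sqrt h)⁻¹ * CFC.sqrt (h + (t : ℂ) • Θ)).det‖ : ℝ) : ℂ)) ^ (4 - 2 * α - 2 * β) =
      (1 + (t : ℂ) • ((CFC.sqrt h)⁻¹ * Θ * (CFC.sqrt h)⁻¹)).det ^ (2 - α - β) := by
    rw [show (4 - 2 * α - 2 * β : ℂ) = 2 * (2 - α - β) by ring, ofReal_cpow_two_mul hr, det_one_add_smul_bridgeDir hh ht]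
  have hD : (1 + (t : ℂ) • ((CFC.sqrt h)⁻¹ * Θ * (CFC.sqrt h)⁻¹)).det ≠ 0 := by
    rw [det_one_add_smul_bridgeDir hh ht]
    exact_mod_cast (pow_pos hr 2).ne'
  rw [hlevi, hscal, ← mul_assoc, ← cpow_add _ _ hD, show α + β - 2 + (2 - α - β) = (0 : ℂ) by ring, cpow_zero, one_mul]

/-! ## §3 Positivity near `t = 0` -/

/-- **`h + tΘ > 0` for all real `t` near `0`** (`h > 0`, `Θ` hermitian `2 × 2`). [folklore] -/
theorem eventually_posDef_add_smul {h Θ : Matrix (Fin 2) (Fin 2) ℂ} (hh : h.PosDef) (hΘ : Θ.IsHermitian) :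
    ∀ᶠ t : ℝ in 𝓝 0, (h + (t : ℂ) • Θ).PosDef := by
  -- charts
  have hh' : hermTwo ((h 0 0).re, h 0 1, (h 1 1).re) = h := hermTwo_eq_of_isHermitian hh.1
  have hΘ' : hermTwo ((Θ 0 0).re, Θ 0 1, (Θ 1 1).re) = Θ := hermTwo_eq_of_isHermitian hΘ
  set e : ℝ × ℂ × ℝ := ((h 0 0).re, h 0 1, (h 1 1).re) with he
  set θ : ℝ × ℂ × ℝ := ((Θ 0 0).re, Θ 0 1, (Θ 1 1).re) with hθ
  have hpos := (posDef_hermTwo_iff e).mp (hh'.symm ▸ hh)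
  have hcont₁ : Continuous fun t : ℝ => (e + t • θ).1 := by fun_prop
  have hcont₂ : Continuous fun t : ℝ => (e + t • θ).1 * (e + t • θ).2.2 - normSq (e + t • θ).2.1 := by fun_prop
  have h1 : ∀ᶠ t : ℝ in 𝓝 0, 0 < (e + t • θ).1 :=
    (hcont₁.tendsto 0).eventually (eventually_gt_nhds (by simpa using hpos.1))
  have h2 : ∀ᶠ t : ℝ in 𝓝 0, 0 < (e + t • θ).1 * (e + t • θ).2.2 - normSq (e + t • θ).2.1 :=
    (hcont₂.tendsto 0).eventually (eventually_gt_nhds (by simpa using hpos.2))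
  filter_upwards [h1, h2] with t ht1 ht2
  have hchart : h + (t : ℂ) • Θ = hermTwo (e + t • θ) := by
    rw [K2LiuHermTwoEtaDefs.hermTwo_add, K2LiuHermTwoEtaDefs.hermTwo_smul, hh', hθ, hΘ']
  rw [hchart, posDef_hermTwo_iff]
  exact ⟨ht1, by linarith⟩

/-- hence **the pointwise identity of §2 holds for all real `t` near `0`**. [cite: Shimura1997, §16.4] -/
theorem eventually_xiTwo_hLine_eq_gLine {h Θ : Matrix (Fin 2) (Fin 2) ℂ} (hh : h.PosDef) (hΘ : Θ.IsHermitian) (α β : ℂ) :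
    ∀ᶠ t : ℝ in 𝓝 0, xiTwo 1 (h + (t : ℂ) • Θ) α β =
      (1 + (t : ℂ) • ((CFC.sqrt h)⁻¹ * Θ * (CFC.sqrt h)⁻¹)).det ^ (α + β - 2) * xiTwo (1 + (t : ℂ) • ((CFC.sqrt h)⁻¹ * Θ * (CFC.sqrt h)⁻¹)) h α β := by
  filter_upwards [eventually_posDef_add_smul hh hΘ] with t ht
  exact xiTwo_hLine_eq_gLine hh ht α β

end Summit.HodgeConjecture.HodgeConjecture.Cruxes.HLiu418.K2LiuXiTwoHLineAsGLine

end
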